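import Mathlib
import HarnessLib

/-!
# Format C, design C∞: the `log²` tail sum `Σ_{m ≥ M} (A + B log m)²/m²` in closed form

Route context: Fourier–Galerkin / Schur-complement certificates of Weil positivity on a window ("format C";
cell memo `run/shared/lean/pub/rh-explicit/rh-explicit-weil-10/KERNEL-LEVER.md` §19 addendum (the `Uq` tail of the C∞ door);
supporting stmt-RiemannHypothesis-0098; seat rh-explicit-weil-10).

The profile images of the C∞ certificate contain the Re ψ family, which grows like `log m`
(`abs_setIntegral_weilArchDensity_mul_one_sub_cos_le`); envelope tails of the coupling majorant (`coupling_majorant_split`)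
therefore need an explicit bound for `Σ_{m∈[K+1,N)} (A + B log m)²/m²`.  Integral comparison with the antiderivative
`G(x) = ((A + B log x)² + 2B(A + B log x) + 2B²)/x` (`G′ = −(A + B log x)²/x²`):

* `hasDerivAt_logSqPrimitive` — the derivative of `−G`;
* `logSq_div_sq_antitoneOn` — `x ↦ (A + B log x)²/x²` is antitone on `[1, ∞)` for `0 ≤ B ≤ A`;
* `sum_Ico_logSq_div_sq_le` — for `1 ≤ K`: `Σ_{m∈[K+1,N)} (A + B log m)²/m² ≤ G(K)` (every `N`).

Elementary calculus; standard axioms; no definitions; no RH claim.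
-/

-- `Summit.RiemannHypothesis.RiemannHypothesis.…` is the layout-mandated namespace (summit = problem name).
set_option linter.dupNamespace false

noncomputable section

namespace Summit.RiemannHypothesis.RiemannHypothesis.Theorems.WeilFormatC

open Set Finset MeasureTheory intervalIntegral

/-- The primitive: `d/dx [−((A + B log x)² + 2B(A + B log x) + 2B²)/x] = (A + B log x)²/x²` for `x > 0`. -/
theorem hasDerivAt_logSqPrimitive (A B : ℝ) {x : ℝ} (hx : 0 < x) :
    HasDerivAt (fun x : ℝ ↦ -(((A + B * Real.log x) ^ 2 + 2 * B * (A + B * Real.log x) + 2 * B ^ 2) / x))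
      ((A + B * Real.log x) ^ 2 / x ^ 2) x := by
  have hl : HasDerivAt (fun x : ℝ ↦ A + B * Real.log x) (B * x⁻¹) x :=
    ((Real.hasDerivAt_log hx.ne').const_mul B).const_add A
  have hsq : HasDerivAt (fun x : ℝ ↦ (A + B * Real.log x) ^ 2)
      (B * x⁻¹ * (A + B * Real.log x) + (A + B * Real.log x) * (B * x⁻¹)) x := by
    have h := hl.mul hl
    simp only [← sq] at h
    exact h
  have hnum : HasDerivAt (fun x : ℝ ↦ (A + B * Real.log x) ^ 2 + 2 * B * (A + B * Real.log x) + 2 * B ^ 2)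
      (B * x⁻¹ * (A + B * Real.log x) + (A + B * Real.log x) * (B * x⁻¹) + 2 * B * (B * x⁻¹)) x :=
    (hsq.add (hl.const_mul (2 * B))).add_const (2 * B ^ 2)
  have hdiv := hnum.div (hasDerivAt_id x) hx.ne'
  have hneg := hdiv.neg
  refine hneg.congr_deriv ?_
  simp only [id]
  field_simp
  ring

/-- `x ↦ (A + B log x)²/x²` is antitone on `[1, ∞)` when `0 ≤ B ≤ A`. -/
theorem logSq_div_sq_antitoneOn {A B : ℝ} (hB : 0 ≤ B) (hBA : B ≤ A) :
    AntitoneOn (fun x : ℝ ↦ (A + B * Real.log x) ^ 2 / x ^ 2) (Ici 1) := by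
  have hA : 0 ≤ A := hB.trans hBA
  -- derivative on the interior
  have hderiv : ∀ x ∈ interior (Ici (1 : ℝ)),
      HasDerivAt (fun x : ℝ ↦ (A + B * Real.log x) ^ 2 / x ^ 2)
        ((2 * (A + B * Real.log x) * (B * x⁻¹) * x ^ 2 - (A + B * Real.log x) ^ 2 * (2 * x)) / (x ^ 2) ^ 2) x := by
    intro x hx
    rw [interior_Ici] at hx
    have hx0 : 0 < x := lt_trans zero_lt_one hx
    have hl : HasDerivAt (fun x : ℝ ↦ A + B * Real.log x) (B * x⁻¹) x :=
      ((Real.hasDerivAt_log hx0.ne').const_mul B).const_add A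
    have h1 : HasDerivAt (fun x : ℝ ↦ (A + B * Real.log x) ^ 2) (2 * (A + B * Real.log x) * (B * x⁻¹)) x := by
      have h := hl.mul hl
      simp only [← sq] at h
      refine h.congr_deriv ?_
      ring
    have h2 : HasDerivAt (fun x : ℝ ↦ x ^ 2) (2 * x) x := by
      have h := (hasDerivAt_id x).mul (hasDerivAt_id x)
      simp only [id, ← sq] at h
      refine h.congr_deriv ?_
      ring
    exact h1.div h2 (by positivity)
  refine antitoneOn_of_deriv_nonpos (convex_Ici 1) ?_ ?_ ?_
  · -- continuity on `[1, ∞)`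
    refine ContinuousOn.div ?_ (continuousOn_id.pow 2) fun x hx ↦ by
      have : (1 : ℝ) ≤ x := hx
      positivity
    exact ((continuousOn_const.add (continuousOn_const.mul
      (Real.continuousOn_log.mono fun x hx ↦ by
        have : (1 : ℝ) ≤ x := hx
        exact ne_of_gt (lt_of_lt_of_le zero_lt_one this)))).pow 2)
  · intro x hx
    exact (hderiv x hx).differentiableAt.differentiableWithinAt
  · intro x hx
    rw [(hderiv x hx).deriv]
    rw [interior_Ici] at hx
    have hx0 : 0 < x := lt_trans zero_lt_one hx
    have hlog : 0 ≤ Real.log x := Real.log_nonneg hx.le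
    have hu : 0 ≤ A + B * Real.log x := by nlinarith
    have hv : B - A - B * Real.log x ≤ 0 := by nlinarith
    have hnum : 2 * (A + B * Real.log x) * (B * x⁻¹) * x ^ 2 - (A + B * Real.log x) ^ 2 * (2 * x)
        = 2 * x * (A + B * Real.log x) * (B - A - B * Real.log x) := by
      field_simp
      ring
    rw [hnum]
    apply div_nonpos_of_nonpos_of_nonneg _ (by positivity)
    have : 0 ≤ 2 * x * (A + B * Real.log x) := by positivity
    nlinarith

/-- **The `log²` tail**: for `1 ≤ K`, `0 ≤ B ≤ A` and every `N`,
`Σ_{m∈[K+1,N)} (A + B log m)²/m² ≤ ((A + B log K)² + 2B(A + B log K) + 2B²)/K`. -/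
theorem sum_Ico_logSq_div_sq_le {A B : ℝ} (hB : 0 ≤ B) (hBA : B ≤ A) {K : ℕ} (hK : 1 ≤ K) (N : ℕ) :
    ∑ m ∈ Finset.Ico (K + 1) N, (A + B * Real.log m) ^ 2 / (m : ℝ) ^ 2
      ≤ ((A + B * Real.log K) ^ 2 + 2 * B * (A + B * Real.log K) + 2 * B ^ 2) / K := by
  have hA : 0 ≤ A := hB.trans hBA
  have hK0 : (0 : ℝ) < K := by exact_mod_cast hK
  have hK1 : (1 : ℝ) ≤ K := by exact_mod_cast hK
  have hlogK : 0 ≤ Real.log K := Real.log_nonneg hK1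
  have hGK : 0 ≤ ((A + B * Real.log K) ^ 2 + 2 * B * (A + B * Real.log K) + 2 * B ^ 2) / K := by
    have : 0 ≤ A + B * Real.log K := by nlinarith
    positivity
  rcases le_or_gt N (K + 1) with hN | hN
  · rw [Finset.Ico_eq_empty (by omega)]
    simpa using hGK
  -- `N = N' + 1` with `K ≤ N'`
  obtain ⟨N', rfl⟩ : ∃ N', N = N' + 1 := ⟨N - 1, by omega⟩
  have hKN : K ≤ N' := by omega
  -- reindex and compare with the integral
  have hre : ∑ m ∈ Finset.Ico (K + 1) (N' + 1), (A + B * Real.log m) ^ 2 / (m : ℝ) ^ 2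
      = ∑ i ∈ Finset.Ico K N', (A + B * Real.log ((i + 1 : ℕ) : ℝ)) ^ 2 / (((i + 1 : ℕ) : ℝ)) ^ 2 := by
    rw [← Finset.sum_Ico_add' (fun m : ℕ ↦ (A + B * Real.log m) ^ 2 / (m : ℝ) ^ 2) K N' 1]
  rw [hre]
  have hanti : AntitoneOn (fun x : ℝ ↦ (A + B * Real.log x) ^ 2 / x ^ 2) (Icc (K : ℝ) N') :=
    (logSq_div_sq_antitoneOn hB hBA).mono fun x hx ↦ le_trans hK1 hx.1
  have hcmp := AntitoneOn.sum_le_integral_Ico hKN hanti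
  have hcast : ∑ i ∈ Finset.Ico K N', (A + B * Real.log ((i + 1 : ℕ) : ℝ)) ^ 2 / (((i + 1 : ℕ) : ℝ)) ^ 2
      = ∑ i ∈ Finset.Ico K N', (A + B * Real.log ((i : ℝ) + 1)) ^ 2 / ((i : ℝ) + 1) ^ 2 := by
    refine Finset.sum_congr rfl fun i _ ↦ ?_
    push_cast; ring_nf
  rw [hcast]
  refine (le_trans (by simpa using hcmp) ?_)
  -- the integral by the fundamental theorem of calculus
  have hN0 : (0 : ℝ) < N' := lt_of_lt_of_le hK0 (by exact_mod_cast hKN)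
  have hFTC : ∫ x in (K : ℝ)..N', (A + B * Real.log x) ^ 2 / x ^ 2 =
      -(((A + B * Real.log N') ^ 2 + 2 * B * (A + B * Real.log N') + 2 * B ^ 2) / N')
        - -(((A + B * Real.log K) ^ 2 + 2 * B * (A + B * Real.log K) + 2 * B ^ 2) / K) := by
    refine intervalIntegral.integral_eq_sub_of_hasDerivAt (fun x hx ↦ hasDerivAt_logSqPrimitive A B ?_) ?_
    · rw [Set.uIcc_of_le (by exact_mod_cast hKN)] at hx
      exact lt_of_lt_of_le hK0 hx.1
    · refine ContinuousOn.intervalIntegrable ?_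
      rw [Set.uIcc_of_le (by exact_mod_cast hKN)]
      refine ContinuousOn.div ?_ (continuousOn_id.pow 2) fun x hx ↦ by
        have : (0 : ℝ) < x := lt_of_lt_of_le hK0 hx.1
        positivity
      exact ((continuousOn_const.add (continuousOn_const.mul
        (Real.continuousOn_log.mono fun x hx ↦ ne_of_gt (lt_of_lt_of_le hK0 hx.1)))).pow 2)
  rw [hFTC]
  have hGN : 0 ≤ ((A + B * Real.log N') ^ 2 + 2 * B * (A + B * Real.log N') + 2 * B ^ 2) / N' := by
    have hlogN : 0 ≤ Real.log N' := Real.log_nonneg (le_trans hK1 (by exact_mod_cast hKN))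
    have : 0 ≤ A + B * Real.log N' := by nlinarith
    positivity
  linarith

end Summit.RiemannHypothesis.RiemannHypothesis.Theorems.WeilFormatC

end
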